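import Mathlib.AlgebraicGeometry.Noetherian
import Mathlib.RingTheory.Localization.AtPrime.Basic
import Literature.AlgebraicGeometry.Resolution.WeightedResolutionDatum
import Literature.AlgebraicGeometry.Resolution.SmoothStalksRegular

/-!
# A weighted chart restricted to an affine sub-open, in ring language

Route `ResolutionOfSingularities/WeightedInvariant`, crux `WeightedConstruction`
(stmt-ResolutionOfSingularities-0571), line `support-first-weights-second`, stub
`stub_weightedChart_basicOpen` (stub 1c of the lead skeleton).

Let `f : Y → Spec k` be smooth (`k` a field), `R` a Rees algebra on `Y`
(`ReesAlgebraData`, `WeightedResolutionDatum.lean`) and `(U, u, w)` a weighted chart of `R`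
(`ReesAlgebraData.IsWeightedChart`: positive weights, the pieces `Rₙ(U)` are the weighted monomial
ideals `(u^α : Σ wᵢ αᵢ ≥ n)`, and at every point `y ∈ U` where all `uᵢ` vanish their classes in
`𝔪_y / 𝔪_y²` are linearly independent). For an affine sub-open `V ≤ U` (in the skeleton `V = D(h)`,
a hypothesis that is not used) we transport the chart to `V` and rephrase it in the language of the
ring `Γ(Y, V)`, its primes `P` and localisations at `P` — the hypothesis shape of the tree theorem
`cobordantAlgebra.isRegularRing_of_linearIndependent_toCotangent`:

1. `Γ(Y, V)` is a regular ring: `Y` is locally Noetherian (smooth ⇒ locally of finite type over the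
   Noetherian scheme `Spec k`, `LocallyOfFiniteType.isLocallyNoetherian`), so `Γ(Y, V)` is
   Noetherian; its localisation at a prime `P` is the stalk `𝒪_{Y,y}` at the point `y` of `V`
   corresponding to `P` (`IsAffineOpen.isLocalization_stalk'`), which is a regular local ring
   because `Y` is smooth over a field (`isRegularLocalRing_stalk_of_smooth_of_field`, Stacks 056S).
2. the weights are positive (a field of the chart).
3. `Rₙ(V) = Rₙ(U) · Γ(Y, V)` (`Scheme.IdealSheafData.map_ideal'`) is the weighted monomial ideal of
   the restrictions `uᵢ|_V` (`weightedMonomialIdeal_map`: the image of a monomial is a monomial).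
4. for a prime `P ⊇ (uᵢ|_V)`, the stalk `𝒪_{Y,y}` at the corresponding point `y ∈ V` is a
   localisation of `Γ(Y, V)` at `P`, is regular local, the `uᵢ|_V` map into its maximal ideal
   (`IsLocalization.AtPrime.to_map_mem_maximal_iff`), and their images are the germs of the `uᵢ`
   (`TopCat.Presheaf.germ_res_apply`), whose cotangent classes are linearly independent by the chart
   hypothesis at `y`.
-/

noncomputable section

set_option linter.dupNamespace false -- mandated namespace of this single-conjunct summit

namespace Summit.ResolutionOfSingularities.ResolutionOfSingularities.Theorems

open CategoryTheory AlgebraicGeometry TopologicalSpace Literature.AlgebraicGeometry.Resolution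
open scoped LaurentPolynomial

section Helpers

universe u

/-- The image of a weighted monomial ideal `(u^α : Σ wᵢ αᵢ ≥ n)` under a ring map `φ` is the
weighted monomial ideal of the images `φ (uᵢ)` (same weights, same degree). [folklore] -/
theorem weightedMonomialIdeal_map {A B : Type*} [CommRing A] [CommRing B] (φ : A →+* B) {m : ℕ}
    (u : Fin m → A) (w : Fin m → ℕ) (n : ℕ) :
    (weightedMonomialIdeal u w n).map φ = weightedMonomialIdeal (fun i => φ (u i)) w n := by
  rw [weightedMonomialIdeal, weightedMonomialIdeal, Ideal.map_span]
  congr 1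
  ext x
  constructor
  · rintro ⟨y, ⟨α, hα, rfl⟩, rfl⟩
    exact ⟨α, hα, by simp [map_prod, map_pow]⟩
  · rintro ⟨α, hα, rfl⟩
    exact ⟨_, ⟨α, hα, rfl⟩, by simp [map_prod, map_pow]⟩

/-- **The coordinate ring of an affine open of a scheme smooth over a field is a regular ring**:
it is Noetherian (`Y` is locally Noetherian, being locally of finite type over `Spec k`), and its
localisation at a prime is the stalk of `Y` at the corresponding point, a regular local ring by
Stacks 056S (`isRegularLocalRing_stalk_of_smooth_of_field`). [folklore] -/
theorem isRegularRing_sections_of_smooth_of_field {k : Type u} [Field k] {Y : Scheme.{u}}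
    (f : Y ⟶ Spec (.of k)) [Smooth f] (V : Y.affineOpens) : IsRegularRing Γ(Y, V) := by
  haveI : IsLocallyNoetherian Y := LocallyOfFiniteType.isLocallyNoetherian f
  haveI : IsNoetherianRing Γ(Y, V) := IsLocallyNoetherian.component_noetherian V
  refine isRegularRing_iff.mpr fun p hp => ?_
  have hy : V.2.fromSpec ⟨p, hp⟩ ∈ (V : Y.Opens) := V.2.range_fromSpec.le ⟨_, rfl⟩
  letI : Algebra Γ(Y, V) (Y.presheaf.stalk (V.2.fromSpec ⟨p, hp⟩)) :=
    TopCat.Presheaf.algebra_section_stalk Y.presheaf ⟨V.2.fromSpec ⟨p, hp⟩, hy⟩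
  have hloc : IsLocalization.AtPrime (Y.presheaf.stalk (V.2.fromSpec ⟨p, hp⟩)) p :=
    V.2.isLocalization_stalk' ⟨p, hp⟩ hy
  haveI := isRegularLocalRing_stalk_of_smooth_of_field f (V.2.fromSpec ⟨p, hp⟩)
  exact IsRegularLocalRing.of_ringEquiv
    (IsLocalization.algEquiv p.primeCompl (Y.presheaf.stalk (V.2.fromSpec ⟨p, hp⟩))
      (Localization.AtPrime p)).toRingEquiv

end Helpers

/-- **Stub 1c (a weighted chart on an affine sub-open, in ring language).** Let `f : Y → Spec k`
be smooth, `R` a Rees algebra on `Y` with weighted chart `(U, u, w)`, and `V ≤ U` an affine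
sub-open (a basic open `D(h)` in the skeleton; that hypothesis is not used). Then: `Γ(Y, V)` is a
regular ring; the weights are positive; the pieces `Rₙ(V)` are the weighted monomial ideals of the
restrictions `uᵢ|_V`; and for every prime `P` of `Γ(Y, V)` containing the `uᵢ|_V` there is a
localisation `Rg` of `Γ(Y, V)` at `P` (namely the stalk `𝒪_{Y,y}` at the point `y ∈ V`
corresponding to `P`) which is a regular local ring, in whose maximal ideal the `uᵢ|_V` land with
linearly independent classes in the cotangent space `𝔪 / 𝔪²` (the chart hypothesis at `y`,
transported along `germ_V ∘ res = germ_U`). [folklore] -/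
theorem stub_weightedChart_basicOpen :
    ∀ ⦃k : Type⦄ [Field k] ⦃Y : Scheme.{0}⦄ (f : Y ⟶ Spec (.of k)) [Smooth f]
      (R : ReesAlgebraData Y) (U : Y.affineOpens) {m : ℕ} (u : Fin m → Γ(Y, U)) (w : Fin m → ℕ),
      R.IsWeightedChart U u w →
      ∀ (h : Γ(Y, U)) (V : Y.affineOpens) (hVU : (V : Y.Opens) ≤ U),
        (V : Y.Opens) = Y.basicOpen h →
        IsRegularRing Γ(Y, V) ∧ (∀ i, 0 < w i) ∧
        (∀ n, R.chartIdeals V n =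
          weightedMonomialIdeal (fun i => (Y.presheaf.map (homOfLE hVU).op).hom (u i)) w n) ∧
        (∀ (P : Ideal Γ(Y, V)) [P.IsPrime],
          Ideal.span (Set.range fun i => (Y.presheaf.map (homOfLE hVU).op).hom (u i)) ≤ P →
          ∃ (Rg : Type) (_ : CommRing Rg) (_ : Algebra Γ(Y, V) Rg) (_ : IsLocalization.AtPrime Rg P)
            (_ : IsRegularLocalRing Rg)
            (hmem : ∀ i, algebraMap Γ(Y, V) Rg ((Y.presheaf.map (homOfLE hVU).op).hom (u i)) ∈
              IsLocalRing.maximalIdeal Rg),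
            LinearIndependent (IsLocalRing.ResidueField Rg) fun i =>
              (IsLocalRing.maximalIdeal Rg).toCotangent
                ⟨algebraMap Γ(Y, V) Rg ((Y.presheaf.map (homOfLE hVU).op).hom (u i)), hmem i⟩) := by
  intro k _ Y f _ R U m u w hchart _ V hVU _
  refine ⟨isRegularRing_sections_of_smooth_of_field f V, hchart.w_pos, fun n => ?_, ?_⟩
  · -- (3) the pieces over `V` are the restricted pieces over `U`
    rw [ReesAlgebraData.chartIdeals_apply, ← (R.piece n).map_ideal' (U := V) (V := U)
      (homOfLE hVU).op, hchart.ideal_eq n, weightedMonomialIdeal_map]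
  · -- (4) localisation at a prime containing the restricted parameters
    intro P hPp hP
    -- the point of `V ⊆ Y` corresponding to the prime `P`
    have hyV : V.2.fromSpec ⟨P, hPp⟩ ∈ (V : Y.Opens) := V.2.range_fromSpec.le ⟨_, rfl⟩
    letI : Algebra Γ(Y, V) (Y.presheaf.stalk (V.2.fromSpec ⟨P, hPp⟩)) :=
      TopCat.Presheaf.algebra_section_stalk Y.presheaf ⟨V.2.fromSpec ⟨P, hPp⟩, hyV⟩
    have hloc : IsLocalization.AtPrime (Y.presheaf.stalk (V.2.fromSpec ⟨P, hPp⟩)) P :=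
      V.2.isLocalization_stalk' ⟨P, hPp⟩ hyV
    have hreg : IsRegularLocalRing (Y.presheaf.stalk (V.2.fromSpec ⟨P, hPp⟩)) :=
      isRegularLocalRing_stalk_of_smooth_of_field f _
    -- `germ_V (uᵢ|_V) = germ_U uᵢ`
    have hgermres : ∀ i, algebraMap Γ(Y, V) (Y.presheaf.stalk (V.2.fromSpec ⟨P, hPp⟩))
        ((Y.presheaf.map (homOfLE hVU).op).hom (u i)) =
        (Y.presheaf.germ U (V.2.fromSpec ⟨P, hPp⟩) (hVU hyV)).hom (u i) := by
      intro i
      exact TopCat.Presheaf.germ_res_apply Y.presheaf (homOfLE hVU) _ hyV (u i)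
    have hmemP : ∀ i, (Y.presheaf.map (homOfLE hVU).op).hom (u i) ∈ P := fun i =>
      hP (Ideal.subset_span ⟨i, rfl⟩)
    have hmem : ∀ i, algebraMap Γ(Y, V) (Y.presheaf.stalk (V.2.fromSpec ⟨P, hPp⟩))
        ((Y.presheaf.map (homOfLE hVU).op).hom (u i)) ∈
        IsLocalRing.maximalIdeal (Y.presheaf.stalk (V.2.fromSpec ⟨P, hPp⟩)) := fun i =>
      (IsLocalization.AtPrime.to_map_mem_maximal_iff _ P _).mpr (hmemP i)
    have hgerm : ∀ i, (Y.presheaf.germ U (V.2.fromSpec ⟨P, hPp⟩) (hVU hyV)).hom (u i) ∈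
        IsLocalRing.maximalIdeal (Y.presheaf.stalk (V.2.fromSpec ⟨P, hPp⟩)) := fun i =>
      hgermres i ▸ hmem i
    refine ⟨Y.presheaf.stalk (V.2.fromSpec ⟨P, hPp⟩), inferInstance, inferInstance, hloc, hreg,
      hmem, ?_⟩
    have hli := hchart.linearIndependent (V.2.fromSpec ⟨P, hPp⟩) (hVU hyV) hgerm
    have hfun : (fun i => (IsLocalRing.maximalIdeal (Y.presheaf.stalk (V.2.fromSpec ⟨P, hPp⟩))).toCotangent
        ⟨algebraMap Γ(Y, V) (Y.presheaf.stalk (V.2.fromSpec ⟨P, hPp⟩))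
          ((Y.presheaf.map (homOfLE hVU).op).hom (u i)), hmem i⟩) =
        (fun i => (IsLocalRing.maximalIdeal (Y.presheaf.stalk (V.2.fromSpec ⟨P, hPp⟩))).toCotangent
          ⟨(Y.presheaf.germ U (V.2.fromSpec ⟨P, hPp⟩) (hVU hyV)).hom (u i), hgerm i⟩) := by
      funext i
      congr 1
      exact Subtype.ext (hgermres i)
    rw [hfun]
    exact hli

end Summit.ResolutionOfSingularities.ResolutionOfSingularities.Theorems

end
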